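import Summits.QuantumFields.BalabanUV.T4Continuum.Support.NE7FlatHkOrthogonal
import HarnessLib

/-!
# NE7FlatHkOrthogonalStraight — (R⊥♭) ON THE STRAIGHT-TANGENT TEST CLASS: lit-balaban's flat Landau lift `R_H B` (pulled back entrywise and corrected, F36) is
# `hess`-ORTHOGONAL at the flat background to every skew periodic `Y` with VANISHING STRAIGHT `(j+1)`-FOLD AVERAGE, `(Qcoarse L)^[j+1] Y = 0` — the direct case
# `g = 0` of F40b's argument (the torus restriction of every entry of `Y` lies in `ker Q_k`, where lit-balaban's `curl_HkOp_orthogonal` applies without the coarse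
# gauge correction)

Cell `pub-balaban`, rung (B)+1 sub-cell t4, lineage `b2b-balaban-t4-ne7-p1` (CRUX PROVER NE7 #1 = OWNER of row NE7), generation 89; memo
`t4/b2b-balaban-t4-ne7-p1-g89/COSTING-N1.md` §7.  File F262 (over F40b `NE7FlatHkOrthogonal` — `sum_conj_Fs_mul_Fs_HkOp_eq_zero` and the proof of `hess_flat_hkLift_eq_zero`
BY NAME and verbatim —, F35 `NE7FlatAverageBridge.linQ_pullback_eq`, F36 `linQ_apply_entry`, row NE3's `iterate_Qcoarse_apply`).

WHY (memo §7, the v4 test class).  The torus road's defect letter is small on STRAIGHT-tangent tests, not on flat-tangent ones; the bootstrap (F260) is parametric in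
the test class, and its (R⊥) letter must then hold on straight-tangent `Y`.  F40b proved (R⊥♭) for flat-tangent `Y` through the coarse-exact reading `Q_ky = ∂₁g`; for
straight-tangent `Y` the reading is `Q_ky = 0` (F35: the straight average of a pull-back is `n·Q_k`), the `g = 0` case.
WHAT ([folklore] dictionary bookkeeping; 0 def, 0 sorry).  §1 `qvOp_entry_straight` (`(Qcoarse L)^[j+1] Y = 0 ⟹ Q_k y_{ii′} = 0` for every entry of the torus
restriction); §2 **`hess_flat_hkLift_eq_zero_straight`** — `hess 1 (R_H B) Y (perWin d (n·P)) = 0` for every skew `(n·P)`-periodic `Y` with `(Qcoarse L)^[j+1] Y = 0`.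
HONEST FRAMING (page 1): index bookkeeping over lit-balaban's kernel theorem (abelian, flat, `U = 1`); nothing of Bałaban's asserted; NOT (APE), NOT ONE-STEP, NOT NE7;
spine 0∕9; finite T⁴ rung (B)+1 — NOT infinite volume, NOT mass gap, NOT `BetaPertH`, NOT Clay.  Continuum YM on T⁴ ⇐ BetaPertH ∧ nine spine estimates (0/9 proved);
BetaPertH ⇐ (D1) ∧ (D4) ∧ CAP+tail; G-an2-4 gates asym, D1 and NE2/3/4.
-/

set_option autoImplicit false

open scoped BigOperators Matrix ComplexConjugate Matrix.Norms.L2Operator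
open Finset

namespace Summit.QuantumFields.BalabanUV.T4Continuum.NE7FlatHkOrthogonalStraight

open Literature.MathematicalPhysics.QuantumFieldTheory.Balaban1983to89
open B7Prop1Explicit (Site e e_apply)
open T4AveragingDeficitWall (curlAt curl IsSkewDir SmallField)
open AveragingDeficitPeriodicCounting (IsPeriodicDir)
open B5Prop11Plancherel (Tor fine)
open B5Action121 (Fs Fs_apply GradOp GradOp_mulVec sdiff_mulVec CurlOp CurlOp_mulVec)
open B5Block118 (QvOp)
open B5Blocks16 (blockOf QsOp_blockConst)
open B5Hk160Torus (QvOp_GradOp_mulVec)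
open B5Hk163Torus (HkOp)
open B5Hk163RDiv (curl_HkOp_orthogonal)
open B6Lemma24Torus (pbox mem_pbox IsPeriod)
open B6LowerBound2153Torus (toT rep toT_add toT_rep rep_toT rep_mem_pbox isPeriod_rep_toT_sub)
open BlockAveragePushDirSplit (flat)
open SmoothRefineInterp (interp)
open NE3TangentNoGoWords (dPot)
open NE3TangentFlatStructure (framePot Qcoarse iterate_Tcoarse_eq_zero_iff framePot_add_period)
open NE3SmoothRightInverseFlat (cpushIter_flat iterate_Qcoarse_apply)
open NE7FlatAverageBridge (linQ_pullback_eq)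
open NE7FlatHkRightInverse (linQ_apply_entry)
open B7Prop3Flat (linQ)
open B7Prop4Flat (linQ_eq_sum)
open ReplicationRightInverse (cpushIter)
open NE3SmoothLiftCurl (curlAt_flat_eq)
open NE3SmoothRightInverseCurl (curlAt_flat_dPot curlAt_flat_add)
open NE3HessForm (hess)
open MinimalActionLevels (perWin)
open NE3FlatHessianCurl (smallField_flatCfg_zero)
open NE3TangentFlatPush (flatCfg_eq_flat)
open NE7ApeFlatSkeleton (hess_flat)
open NE7FlatHkOrthogonal (Fs_eq_mul_Fs_one sum_conj_Fs_mul_Fs_HkOp_eq_zero entry_eq_neg_conj_of_skew)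
open NE7TorusBoxDictionary (sum_periodBox_toT sum_sum_eq_two_mul_sum_plane_complex toT_add_e' apply_rep_toT' curlAt_flat_entry_torus)

noncomputable section

variable {d : ℕ} {n : Type*} [Fintype n] [DecidableEq n]

/-! ## §1 Straight-tangent directions have entries in `ker Q_k` -/

/-- **A STRAIGHT-TANGENT DIRECTION HAS, ENTRY BY ENTRY, A `ker Q_k` TORUS RESTRICTION**: for `Y` `(n·P)`-periodic (`n = L^{j+1}`) with `(Qcoarse L)^[j+1] Y = 0`, every
entry `y_{ii′}(p) = Y(rep p.1, p.2)_{ii′}` satisfies `Q_k y_{ii′} = 0` (the straight `(j+1)`-fold average is `n·Q_k` on pull-backs, F35). [folklore] -/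
theorem qvOp_entry_straight {L : ℕ} (j : ℕ) {P : ℕ} [NeZero P] [NeZero (L ^ (j + 1))]
    {Y : Site d → Fin d → Matrix n n ℂ} (hYP : IsPeriodicDir Y ((L ^ (j + 1) * P : ℕ) : ℤ))
    (hYQ : (Qcoarse L)^[j + 1] Y = 0) (i i' : n) (t : Tor (fun _ : Fin d => P)) (κ : Fin d) :
    (QvOp (L ^ (j + 1)) (fun _ : Fin d => P) *ᵥ
        fun p : Tor (fine (L ^ (j + 1)) (fun _ : Fin d => P)) × Fin d =>
          Y (rep (fine (L ^ (j + 1)) (fun _ : Fin d => P)) p.1) p.2 i i') (t, κ) = 0 := by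
  have hnc : ((L ^ (j + 1) : ℕ) : ℂ) ≠ 0 := by exact_mod_cast NeZero.ne (L ^ (j + 1))
  haveI hNP : NeZero (L ^ (j + 1) * P) := ⟨Nat.mul_ne_zero (NeZero.ne (L ^ (j + 1))) (NeZero.ne P)⟩
  have hz := congrFun (congrFun hYQ (rep (fun _ : Fin d => P) t)) κ
  rw [iterate_Qcoarse_apply] at hz
  have hent := congrFun (congrFun hz i) i'
  rw [linQ_apply_entry] at hent
  -- the entry field is the pull-back of its torus restriction
  have hpull : (fun (x : Site d) (μ : Fin d) => Y x μ i i')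
      = fun (x : Site d) (μ : Fin d) => (fun p : Tor (fine (L ^ (j + 1)) (fun _ : Fin d => P)) × Fin d =>
          Y (rep (fine (L ^ (j + 1)) (fun _ : Fin d => P)) p.1) p.2 i i') (toT (fine (L ^ (j + 1)) (fun _ : Fin d => P)) x, μ) := by
    funext x μ
    exact (apply_rep_toT' (P := L ^ (j + 1) * P) hYP x μ ▸ rfl)
  have hlin := linQ_pullback_eq (L ^ (j + 1)) (fun _ : Fin d => P)
    (fun p : Tor (fine (L ^ (j + 1)) (fun _ : Fin d => P)) × Fin d => Y (rep (fine (L ^ (j + 1)) (fun _ : Fin d => P)) p.1) p.2 i i') t κ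
  rw [← hpull, hent] at hlin
  -- `hlin : 0 = n * (Q_k y)(t,κ)`
  have h0 : ((L ^ (j + 1) : ℕ) : ℂ) * (QvOp (L ^ (j + 1)) (fun _ : Fin d => P) *ᵥ
      fun p : Tor (fine (L ^ (j + 1)) (fun _ : Fin d => P)) × Fin d => Y (rep (fine (L ^ (j + 1)) (fun _ : Fin d => P)) p.1) p.2 i i') (t, κ) = 0 := by
    rw [← hlin]; rfl
  exact (mul_eq_zero.mp h0).resolve_left hnc

/-! ## §2 (R⊥♭) on straight-tangent directions -/

/-- **THE (R⊥♭) LETTER ON STRAIGHT-TANGENT TESTS**: `hess 1 (R_H B) Y (perWin d (n·P)) = 0` for every skew `(n·P)`-periodic `Y` with `(Qcoarse L)^[j+1] Y = 0`, every `B`,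
every `L`, `j`, `P ≥ 1` with `L^{j+1} ≠ 0` — F40b's proof with `g := 0`. [folklore] -/
theorem hess_flat_hkLift_eq_zero_straight {L : ℕ} (j : ℕ) {P : ℕ} [NeZero P] [NeZero (L ^ (j + 1))]
    (B : Tor (fun _ : Fin d => P) × Fin d → Matrix n n ℂ)
    {Y : Site d → Fin d → Matrix n n ℂ} (hYs : IsSkewDir Y) (hYP : IsPeriodicDir Y ((L ^ (j + 1) * P : ℕ) : ℤ))
    (hYQ : (Qcoarse L)^[j + 1] Y = 0) :
    hess (flat (d := d) (n := n))
        ((fun (x : Site d) (κ : Fin d) => Matrix.of fun i i' : n =>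
            (HkOp (L ^ (j + 1)) (fun _ : Fin d => P) *ᵥ fun p : Tor (fun _ : Fin d => P) × Fin d => B p i i')
              (toT (fine (L ^ (j + 1)) (fun _ : Fin d => P)) x, κ))
          + dPot (interp (L ^ (j + 1)) Finset.univ (framePot L (j + 1)
              (fun (x : Site d) (κ : Fin d) => Matrix.of fun i i' : n =>
                (HkOp (L ^ (j + 1)) (fun _ : Fin d => P) *ᵥ fun p : Tor (fun _ : Fin d => P) × Fin d => B p i i')
                  (toT (fine (L ^ (j + 1)) (fun _ : Fin d => P)) x, κ)))))
        Y (perWin d (L ^ (j + 1) * P)) = 0 := by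
  haveI hNP : NeZero (L ^ (j + 1) * P) := ⟨Nat.mul_ne_zero (NeZero.ne (L ^ (j + 1))) (NeZero.ne P)⟩
  -- abbreviations
  set F : Fin d → ℕ := fine (L ^ (j + 1)) (fun _ : Fin d => P) with hF
  set h : n → n → (Tor F × Fin d → ℂ) :=
    fun i i' => HkOp (L ^ (j + 1)) (fun _ : Fin d => P) *ᵥ fun p : Tor (fun _ : Fin d => P) × Fin d => B p i i' with hh
  set AH : Site d → Fin d → Matrix n n ℂ := fun x κ => Matrix.of fun i i' : n => h i i' (toT F x, κ) with hAH
  set y : n → n → (Tor F × Fin d → ℂ) := fun i i' p => Y (rep F p.1) p.2 i i' with hy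
  set G := interp (L ^ (j + 1)) Finset.univ (framePot L (j + 1) AH) with hG
  -- the pairing
  have hflat0 : SmallField (flat (d := d) (n := n)) 0 := by rw [← flatCfg_eq_flat]; exact smallField_flatCfg_zero
  rw [hess_flat hflat0, neg_eq_zero]
  -- entrywise flat curls
  have hXe : ∀ (z : Site d) (μ ν : Fin d) (i i' : n), curlAt (flat (d := d) (n := n)) (AH + dPot G) z μ ν i i' = Fs F 1 (h i i') μ ν (toT F z) := by
    intro z μ ν i i'
    rw [curlAt_flat_add, curlAt_flat_dPot, add_zero, hAH, curlAt_flat_eq, Fs_apply, one_mul, toT_add_e', toT_add_e']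
    simp only [Matrix.sub_apply, Matrix.of_apply]
    ring
  have hYe : ∀ (z : Site d) (μ ν : Fin d) (i i' : n), curlAt (flat (d := d) (n := n)) Y z μ ν i i' = Fs F 1 (y i i') μ ν (toT F z) :=
    fun z μ ν i i' => curlAt_flat_entry_torus (P := L ^ (j + 1) * P) hYP z μ ν i i'
  -- skewness on the torus side
  have hskew : ∀ (μ ν : Fin d) (tt : Tor F) (i i' : n), Fs F 1 (y i i') μ ν tt = -conj (Fs F 1 (y i' i) μ ν tt) := by
    intro μ ν tt i i'
    simp only [Fs_apply, one_mul, hy, entry_eq_neg_conj_of_skew (hYs _ _) i i', map_add, map_sub]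
    ring
  -- the entry pairing of one plaquette
  set c : n × n → T4AveragingDeficitWall.Plaq d → ℂ :=
    fun e p => conj (Fs F 1 (y e.1 e.2) p.2.1.1 p.2.1.2 (toT F p.1)) * Fs F 1 (h e.1 e.2) p.2.1.1 p.2.1.2 (toT F p.1) with hc
  have hterm : ∀ p : T4AveragingDeficitWall.Plaq d,
      UnitaryModel.nReTr (curl (flat (d := d) (n := n)) Y p * curl (flat (d := d) (n := n)) (AH + dPot G) p)
        = -((∑ e : n × n, c e p).re / Fintype.card n) := by
    intro p
    unfold UnitaryModel.nReTr
    rw [Matrix.trace]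
    simp only [Matrix.diag, Matrix.mul_apply]
    have hsum : ∑ i : n, ∑ i' : n, curl (flat (d := d) (n := n)) Y p i i' * curl (flat (d := d) (n := n)) (AH + dPot G) p i' i
        = -∑ e : n × n, c e p := by
      show ∑ i : n, ∑ i' : n, curlAt (flat (d := d) (n := n)) Y p.1 p.2.1.1 p.2.1.2 i i'
          * curlAt (flat (d := d) (n := n)) (AH + dPot G) p.1 p.2.1.1 p.2.1.2 i' i = -∑ e : n × n, c e p
      rw [Finset.sum_comm, Fintype.sum_prod_type, ← Finset.sum_neg_distrib]
      refine Finset.sum_congr rfl fun i' _ => ?_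
      rw [← Finset.sum_neg_distrib]
      refine Finset.sum_congr rfl fun i _ => ?_
      rw [hYe, hXe, hskew, hc]
      ring
    rw [hsum, Complex.neg_re, neg_div]
  -- every entry pairing vanishes over the period window
  have hinner : ∀ e : n × n, ∑ p ∈ perWin d (L ^ (j + 1) * P), c e p = 0 := by
    intro e
    unfold perWin
    rw [Finset.sum_product]
    have hbox := sum_periodBox_toT (d := d) (L ^ (j + 1) * P)
      (fun tt => ∑ π : T4AveragingDeficitWall.Plane d, conj (Fs F 1 (y e.1 e.2) π.1.1 π.1.2 tt) * Fs F 1 (h e.1 e.2) π.1.1 π.1.2 tt)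
    simp only [hc]
    rw [hbox]
    -- planes ↔ ordered pairs, per torus point
    have hpl : ∀ tt : Tor F, ∑ π : T4AveragingDeficitWall.Plane d, conj (Fs F 1 (y e.1 e.2) π.1.1 π.1.2 tt) * Fs F 1 (h e.1 e.2) π.1.1 π.1.2 tt
        = 1 / 2 * ∑ μ : Fin d, ∑ ν : Fin d, conj (Fs F 1 (y e.1 e.2) μ ν tt) * Fs F 1 (h e.1 e.2) μ ν tt := by
      intro tt
      rw [sum_sum_eq_two_mul_sum_plane_complex (fun μ ν => conj (Fs F 1 (y e.1 e.2) μ ν tt) * Fs F 1 (h e.1 e.2) μ ν tt)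
        (fun μ => by simp [Fs_apply]) (fun μ ν => by
          have a1 : Fs F 1 (y e.1 e.2) ν μ tt = -Fs F 1 (y e.1 e.2) μ ν tt := by rw [Fs_apply, Fs_apply]; ring
          have a2 : Fs F 1 (h e.1 e.2) ν μ tt = -Fs F 1 (h e.1 e.2) μ ν tt := by rw [Fs_apply, Fs_apply]; ring
          simp only [a1, a2, map_neg, neg_mul_neg])]
      ring
    simp only [hpl]
    rw [← Finset.mul_sum,
      sum_conj_Fs_mul_Fs_HkOp_eq_zero (L ^ (j + 1)) (fun _ : Fin d => P) (fun p => B p e.1 e.2) (y e.1 e.2)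
        (fun _ => 0)
        (fun tt κ => by rw [sub_self]; exact qvOp_entry_straight j hYP hYQ e.1 e.2 tt κ),
      mul_zero]
  -- assemble
  calc ∑ p ∈ perWin d (L ^ (j + 1) * P), UnitaryModel.nReTr (curl (flat (d := d) (n := n)) Y p * curl (flat (d := d) (n := n)) (AH + dPot G) p)
      = ∑ p ∈ perWin d (L ^ (j + 1) * P), -((∑ e : n × n, c e p).re / Fintype.card n) := Finset.sum_congr rfl fun p _ => hterm p
    _ = -((∑ p ∈ perWin d (L ^ (j + 1) * P), ∑ e : n × n, c e p).re / Fintype.card n) := by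
        rw [Finset.sum_neg_distrib, Complex.re_sum, Finset.sum_div]
    _ = 0 := by
        rw [Finset.sum_comm]
        simp only [hinner, Finset.sum_const_zero, Complex.zero_re, zero_div, neg_zero]

end

end Summit.QuantumFields.BalabanUV.T4Continuum.NE7FlatHkOrthogonalStraight
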